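/-
Copyright: the b2b-balaban cell (near-miss cell 7), T⁴-continuum fan-out; row NE7b ROUND-2 swarm, seat
t4-ne7b-formalise-leaf-10 (gen 3; sub-row S6g′(e) of `t4/b2b-balaban-t4-ne7b-p1/LEAVES-NE7b.md`, owner's ruling
R-OWNER-22-12 (2); sequel of this lineage's `HistorySiblingMass` (d) and `HistorySiblingMassLayered` (d′)).
Released under the licence of the surrounding project.
-/
import Mathlib
import Summits.QuantumFields.BalabanUV.T4Continuum.Support.HistorySiblingMassLayered

/-!
# Sibling ENTROPY: the symmetrised sibling cost splits EXACTLY into a class-linear part and the LOG-MULTINOMIAL of the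
# class sizes (row S6g′(e))

Summits-side support leaf of the T⁴-continuum cell (rung (B)+1 on a FINITE torus only; NOT infinite volume, NOT the
mass gap, NOT the Clay statement; NOT a proof of the spine estimate NE7b).  Row NE7b, route «COUNT», row S6g′
«MASS-BASED SIBLING COUNT» (R-OWNER-22-12 (2)).  [folklore] real arithmetic and finite sums over ABSTRACT finite index
sets, TREE-FREE; nothing is quoted from print, nothing printed is asserted, no `[cite:]` tag, no `Prop` fact minted;
constants explicit.

WHY.  Rows (b)(c) deliver, per JOIN `H` of a shape tree (`HistorySiblingOrbits.joinCount_mul_prod_factorial_le_pow_mul`,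
`HistorySiblingCanon.card_sortedForest_mul_prod_factorial_le_pow_mul`, binding `HistoryJoins`/`HistoryJoinsCount`), the
symmetrised cost `Σ_g (k_g·log Z_H − log k_g!)` — classes `g` of EQUAL-SHAPE non-host parts, sizes `k_g ≥ 1`, all
attached against one mass `Z_H` (`c·S_H`, the join's total zone mass).  Steps (d)∕(d′) bound it through a RANK on the
classes whose fibres have at most `ρ + 1` classes of rank `ρ` (`HistorySiblingMass.sum_exp_neg_rank_le`): true for
BARE-BIRTH classes (rank = age + fatness), but for COMPOSITE classes (equal-root parts with different sub-trees) the fibre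
hypothesis is a displayed residual (HONEST SCOPE (ii) of `HistorySiblingMass`; this lineage's finding F-leaf10-3: the
fibres of every rank of the form `λ·age + θ·(root fatness) + μ·mass` are super-exponential — heap-ordered step patterns
of the internal mergers —, so that residual is NOT an artefact of the constant `ρ + 1`).  This file removes the rank
from the statement altogether: the cost is, EXACTLY, a one-class cost plus the log-multinomial coefficient of the
class-size vector,

  `Σ_g (k_g·log Z − log k_g!) = (K·log Z − log K!) + log (K! ∕ ∏_g k_g!)`,  `K = Σ_g k_g`  (`classes_cost_eq`),

and the one-class cost is class-linear with NO hypothesis: `K·log Z − log K! ≤ 2K + Z` (`one_class_cost_le`, (d′)'s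
`class_cost_le` at rate `0`).  Summed over the joins with the mass budget `Σ_H Z_H ≤ Ztot` of rows (a)∕(a)-TOTAL
(`joins_cost_le_of_budget`): `≤ 2·#parts + Ztot + Σ_H logMultinomial_H`.  So THE residual of the mass-based sibling
count is the canonical, encoding-free quantity **`Σ_H logMultinomial_H`** — the «SIBLING ENTROPY» of the shape tree: the
entropy of distributing the DISTINCT shapes of one join over its attachment sites.  It VANISHES on every join with a
single class (in particular on every binary join of two parts and on every crowd of equal siblings), it is at most
`K_H·log G_H` (`G_H` = number of classes; `logMultinomial_le_sum_mul_log_card`, the multinomial theorem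
`Finset.sum_pow_eq_sum_piAntidiag`), and under (d)'s rank-fibre hypothesis it is class-linear
(`logMultinomial_le_of_rank`, so (d)∕(d′) are ONE sufficient condition for the residual, not the road itself).

WHAT.  §1 `logMultinomial` (+ `_eq_log_multinomial`, `_nonneg`, `_le_log_factorial`, `_eq_zero_of_card_le_one`).  §2
**`classes_cost_eq`**, `one_class_cost_le`, **`classes_cost_le`**, **`joins_cost_le_of_budget`**.  §3 the two bounds
`logMultinomial_le_sum_mul_log_card`, `logMultinomial_le_of_rank`.  §4 sanity.

HONEST SCOPE.  Arithmetic only.  Whether the sibling entropy `Σ_H log(K_H!∕∏ k!)` of a REALISED shape tree is bounded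
class-linearly (by `θ·mass + λ·partnerAges + A·#nodes`) WITHOUT a genericity display is OPEN in this cell's bookkeeping
(F-leaf10-3: print pays the corresponding entropy through the host's per-volume factor «exp O(1)(MR_j)^{−d}|Z_j|», B16
p. 383 — CONTEXT, not asserted — i.e. by summing partner TYPES against the host volume, a generating-function step that a
per-shape-tree multiplicity bound does not see); until then the binder DISPLAYS it by name.  Rows (a)(b)(c), the TOTAL
and the binding are not here.  NE7b NOT proved.  HONEST DEPENDENCY (cell): continuum YM on T⁴ ⇐ BetaPertH ∧ nine spine
estimates (0/9 proved); BetaPertH ⇐ (D1) ∧ (D4) ∧ CAP+tail; G-an2-4 gates asym, D1 and NE2/3/4.  This file changes none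
of it.
-/

open Finset

namespace Summit.QuantumFields.BalabanUV.T4Continuum.HistorySiblingEntropy

open Summit.QuantumFields.BalabanUV.T4Continuum.HistorySiblingMass

noncomputable section

variable {β : Type*}

/-! ## §1 The log-multinomial of a class-size vector -/

/-- **THE LOG-MULTINOMIAL** of the class sizes `k g`, `g ∈ Gs`: `log K! − Σ_g log k_g!`, `K = Σ_g k_g` (the logarithm of
the multinomial coefficient `K!∕∏ k_g!`, see `logMultinomial_eq_log_multinomial`). [folklore] -/
def logMultinomial (Gs : Finset β) (k : β → ℕ) : ℝ :=
  Real.log ((∑ g ∈ Gs, k g).factorial : ℝ) - ∑ g ∈ Gs, Real.log ((k g).factorial : ℝ)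

/-- the log-multinomial is the logarithm of `Nat.multinomial` [folklore] -/
theorem logMultinomial_eq_log_multinomial (Gs : Finset β) (k : β → ℕ) :
    logMultinomial Gs k = Real.log (Nat.multinomial Gs k : ℝ) := by
  have hspec := Nat.multinomial_spec Gs k
  have hprod : Real.log ((∏ g ∈ Gs, (k g).factorial : ℕ) : ℝ) = ∑ g ∈ Gs, Real.log ((k g).factorial : ℝ) := by
    push_cast
    exact Real.log_prod fun g _ => by exact_mod_cast (Nat.factorial_pos (k g)).ne'
  have hcast : (((∑ g ∈ Gs, k g).factorial : ℕ) : ℝ) =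
      ((∏ g ∈ Gs, (k g).factorial : ℕ) : ℝ) * (Nat.multinomial Gs k : ℝ) := by
    rw [← hspec]; push_cast; ring
  unfold logMultinomial
  rw [hcast, Real.log_mul (by exact_mod_cast (prod_pos fun g _ => Nat.factorial_pos (k g)).ne')
    (by exact_mod_cast (Nat.multinomial_pos Gs k).ne'), hprod]
  ring

/-- the log-multinomial is nonnegative [folklore] -/
theorem logMultinomial_nonneg (Gs : Finset β) (k : β → ℕ) : 0 ≤ logMultinomial Gs k := by
  rw [logMultinomial_eq_log_multinomial]
  exact Real.log_nonneg (by exact_mod_cast Nat.multinomial_pos Gs k)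

/-- the log-multinomial is at most `log K!` [folklore] -/
theorem logMultinomial_le_log_factorial (Gs : Finset β) (k : β → ℕ) :
    logMultinomial Gs k ≤ Real.log ((∑ g ∈ Gs, k g).factorial : ℝ) := by
  unfold logMultinomial
  have : 0 ≤ ∑ g ∈ Gs, Real.log ((k g).factorial : ℝ) :=
    sum_nonneg fun g _ => Real.log_nonneg (by exact_mod_cast Nat.factorial_pos (k g))
  linarith

/-- **ONE CLASS, NO ENTROPY**: a join whose non-host parts form at most one class has log-multinomial `0`. [folklore] -/
theorem logMultinomial_eq_zero_of_card_le_one {Gs : Finset β} (h : Gs.card ≤ 1) (k : β → ℕ) :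
    logMultinomial Gs k = 0 := by
  rcases Nat.le_one_iff_eq_zero_or_eq_one.1 h with h0 | h1
  · rw [card_eq_zero.1 h0]; simp [logMultinomial]
  · obtain ⟨g, rfl⟩ := card_eq_one.1 h1
    simp [logMultinomial]

/-! ## §2 The exact split and the class-linear part -/

/-- **THE EXACT SPLIT**: `Σ_g (k_g·log Z − log k_g!) = (K·log Z − log K!) + logMultinomial`, `K = Σ_g k_g`. [folklore] -/
theorem classes_cost_eq (Gs : Finset β) (k : β → ℕ) (Z : ℝ) :
    ∑ g ∈ Gs, ((k g : ℝ) * Real.log Z - Real.log ((k g).factorial : ℝ)) =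
      ((∑ g ∈ Gs, k g : ℕ) : ℝ) * Real.log Z - Real.log ((∑ g ∈ Gs, k g).factorial : ℝ) + logMultinomial Gs k := by
  unfold logMultinomial
  rw [sum_sub_distrib, ← sum_mul]
  push_cast
  ring

/-- **ONE CLASS AGAINST A MASS, RATE ZERO**: `K·log Z − log K! ≤ 2K + Z` for `Z ≥ 0` (also `K = 0`). [folklore] -/
theorem one_class_cost_le (K : ℕ) {Z : ℝ} (hZ : 0 ≤ Z) :
    (K : ℝ) * Real.log Z - Real.log (K.factorial : ℝ) ≤ 2 * K + Z := by
  rcases Nat.eq_zero_or_pos K with rfl | hK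
  · simp [hZ]
  · have h := class_cost_le (k := K) hK hZ (c := 0) (r := 0) le_rfl le_rfl
    simp only [zero_mul, neg_zero, Real.exp_zero, mul_one, add_zero] at h
    linarith

/-- **THE CLASSES OF ONE JOIN**: sizes `k g`, all against one mass `Z ≥ 0`:
`Σ_g (k_g·log Z − log k_g!) ≤ 2·Σ_g k_g + Z + logMultinomial` — NO rank, NO fibre hypothesis. [folklore] -/
theorem classes_cost_le (Gs : Finset β) (k : β → ℕ) {Z : ℝ} (hZ : 0 ≤ Z) :
    ∑ g ∈ Gs, ((k g : ℝ) * Real.log Z - Real.log ((k g).factorial : ℝ)) ≤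
      2 * ∑ g ∈ Gs, (k g : ℝ) + Z + logMultinomial Gs k := by
  rw [classes_cost_eq]
  have h := one_class_cost_le (∑ g ∈ Gs, k g) hZ
  push_cast at h ⊢
  linarith

/-- **OVER THE JOINS, WITH THE MASS BUDGET**: joins `ℓ ∈ Ls` with classes `Gs ℓ` of sizes `k ℓ g`, each join charged
against its mass `Zp ℓ ≥ 0`, `Σ_ℓ Zp ℓ ≤ Ztot`:
`Σ_ℓ Σ_g (k·log (Zp ℓ) − log k!) ≤ 2·Σ_ℓ Σ_g k + Ztot + Σ_ℓ logMultinomial (Gs ℓ) (k ℓ)` — the residual is the SIBLING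
ENTROPY `Σ_ℓ logMultinomial`, nothing else. [folklore] -/
theorem joins_cost_le_of_budget {α : Type*} (Ls : Finset α) (Gs : α → Finset β) (k : α → β → ℕ) (Zp : α → ℝ)
    (hZ : ∀ ℓ ∈ Ls, 0 ≤ Zp ℓ) {Ztot : ℝ} (hZtot : ∑ ℓ ∈ Ls, Zp ℓ ≤ Ztot) :
    ∑ ℓ ∈ Ls, ∑ g ∈ Gs ℓ, ((k ℓ g : ℝ) * Real.log (Zp ℓ) - Real.log ((k ℓ g).factorial : ℝ)) ≤
      2 * ∑ ℓ ∈ Ls, ∑ g ∈ Gs ℓ, (k ℓ g : ℝ) + Ztot + ∑ ℓ ∈ Ls, logMultinomial (Gs ℓ) (k ℓ) := by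
  have h1 : ∑ ℓ ∈ Ls, ∑ g ∈ Gs ℓ, ((k ℓ g : ℝ) * Real.log (Zp ℓ) - Real.log ((k ℓ g).factorial : ℝ)) ≤
      ∑ ℓ ∈ Ls, (2 * ∑ g ∈ Gs ℓ, (k ℓ g : ℝ) + Zp ℓ + logMultinomial (Gs ℓ) (k ℓ)) :=
    sum_le_sum fun ℓ hℓ => classes_cost_le (Gs ℓ) (k ℓ) (hZ ℓ hℓ)
  have h2 : ∑ ℓ ∈ Ls, (2 * ∑ g ∈ Gs ℓ, (k ℓ g : ℝ) + Zp ℓ + logMultinomial (Gs ℓ) (k ℓ)) =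
      2 * ∑ ℓ ∈ Ls, ∑ g ∈ Gs ℓ, (k ℓ g : ℝ) + ∑ ℓ ∈ Ls, Zp ℓ + ∑ ℓ ∈ Ls, logMultinomial (Gs ℓ) (k ℓ) := by
    rw [mul_sum, ← sum_add_distrib, ← sum_add_distrib]
  linarith

/-! ## §3 Two bounds for the sibling entropy -/

/-- the multinomial coefficient is at most `G^K`, `G` the number of classes (multinomial theorem with all variables `1`)
[folklore] -/
theorem multinomial_le_card_pow (Gs : Finset β) (k : β → ℕ) :
    Nat.multinomial Gs k ≤ Gs.card ^ (∑ g ∈ Gs, k g) := by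
  classical
  set k' : β → ℕ := fun g => if g ∈ Gs then k g else 0 with hk'
  have hcongr : Nat.multinomial Gs k = Nat.multinomial Gs k' :=
    Nat.multinomial_congr fun g hg => by simp [hk', hg]
  have hsum : ∑ g ∈ Gs, k' g = ∑ g ∈ Gs, k g := sum_congr rfl fun g hg => by simp [hk', hg]
  have hmem : k' ∈ Gs.piAntidiag (∑ g ∈ Gs, k g) := by
    rw [mem_piAntidiag]
    refine ⟨hsum, fun g hg => ?_⟩
    by_contra h
    exact hg (by simp [hk', h])
  have hthm := sum_pow_eq_sum_piAntidiag Gs (fun _ : β => (1 : ℕ)) (∑ g ∈ Gs, k g)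
  simp only [sum_const, smul_eq_mul, mul_one, one_pow, prod_const_one] at hthm
  rw [hcongr, hthm]
  exact single_le_sum (f := fun f => Nat.multinomial Gs f) (fun f _ => Nat.zero_le _) hmem

/-- **ENTROPY BOUND**: `logMultinomial ≤ K·log G`, `G` the number of classes of the join — so the sibling entropy of a
join is at most «parts × log(distinct shapes present)». [folklore] -/
theorem logMultinomial_le_sum_mul_log_card (Gs : Finset β) (k : β → ℕ) :
    logMultinomial Gs k ≤ (∑ g ∈ Gs, (k g : ℝ)) * Real.log (Gs.card : ℝ) := by
  rw [logMultinomial_eq_log_multinomial]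
  rcases Nat.eq_zero_or_pos Gs.card with h0 | hpos
  · rw [card_eq_zero.1 h0]; simp
  · have hG : (0 : ℝ) < Gs.card := by exact_mod_cast hpos
    have h := multinomial_le_card_pow Gs k
    have h' : (Nat.multinomial Gs k : ℝ) ≤ (Gs.card : ℝ) ^ (∑ g ∈ Gs, k g) := by exact_mod_cast h
    calc Real.log (Nat.multinomial Gs k : ℝ) ≤ Real.log ((Gs.card : ℝ) ^ (∑ g ∈ Gs, k g)) :=
          Real.log_le_log (by exact_mod_cast Nat.multinomial_pos Gs k) h'
      _ = (∑ g ∈ Gs, (k g : ℝ)) * Real.log (Gs.card : ℝ) := by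
          rw [Real.log_pow]; push_cast; ring

/-- `K·log K − log K! ≥ 0` (`K! ≤ K^K`) [folklore] -/
theorem log_factorial_le_mul_log (K : ℕ) : Real.log (K.factorial : ℝ) ≤ (K : ℝ) * Real.log K := by
  have h : (K.factorial : ℝ) ≤ (K : ℝ) ^ K := by exact_mod_cast Nat.factorial_le_pow K
  calc Real.log (K.factorial : ℝ) ≤ Real.log ((K : ℝ) ^ K) :=
        Real.log_le_log (by exact_mod_cast Nat.factorial_pos K) h
    _ = (K : ℝ) * Real.log K := Real.log_pow K _

/-- **THE RANK ROAD AS A SUFFICIENT CONDITION**: under (d)'s rank-fibre hypothesis (ranks `r g : ℕ` with at most `ρ + 1`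
classes of rank `ρ`, sizes `k g ≥ 1`, rate `c > 0`) the sibling entropy of the join is class-linear:
`logMultinomial ≤ (2 + 1∕(1 − e^{−c})²)·Σ_g k_g + c·Σ_g k_g·r_g` (`layer_cost_le` at `Z := K`). [folklore] -/
theorem logMultinomial_le_of_rank (Gs : Finset β) (k : β → ℕ) (r : β → ℕ) {c : ℝ} (hc : 0 < c)
    (hk : ∀ g ∈ Gs, 1 ≤ k g) (hfib : ∀ ρ : ℕ, (Gs.filter fun g => r g = ρ).card ≤ ρ + 1) :
    logMultinomial Gs k ≤ (2 + 1 / (1 - Real.exp (-c)) ^ 2) * ∑ g ∈ Gs, (k g : ℝ) + c * ∑ g ∈ Gs, (k g : ℝ) * r g := by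
  set K : ℕ := ∑ g ∈ Gs, k g with hK
  have hKcast : (K : ℝ) = ∑ g ∈ Gs, (k g : ℝ) := by rw [hK]; push_cast; rfl
  have hsplit := classes_cost_eq Gs k (K : ℝ)
  have hlayer := layer_cost_le Gs k r (Z := (K : ℝ)) (Nat.cast_nonneg K) hc hk hfib
  have hone : 0 ≤ (K : ℝ) * Real.log K - Real.log (K.factorial : ℝ) := by
    have := log_factorial_le_mul_log K; linarith
  rw [← hK] at hsplit
  rw [hKcast] at hlayer hone hsplit
  have : logMultinomial Gs k ≤
      2 * ∑ g ∈ Gs, (k g : ℝ) + c * ∑ g ∈ Gs, (k g : ℝ) * r g + (∑ g ∈ Gs, (k g : ℝ)) / (1 - Real.exp (-c)) ^ 2 := by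
    linarith
  calc logMultinomial Gs k ≤
        2 * ∑ g ∈ Gs, (k g : ℝ) + c * ∑ g ∈ Gs, (k g : ℝ) * r g + (∑ g ∈ Gs, (k g : ℝ)) / (1 - Real.exp (-c)) ^ 2 := this
    _ = (2 + 1 / (1 - Real.exp (-c)) ^ 2) * ∑ g ∈ Gs, (k g : ℝ) + c * ∑ g ∈ Gs, (k g : ℝ) * r g := by ring

/-! ## §4 Sanity -/

namespace Sanity

/-- a crowd of equal siblings (ONE class of any size): zero entropy -/
example (k : Unit → ℕ) : logMultinomial ({()} : Finset Unit) k = 0 :=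
  logMultinomial_eq_zero_of_card_le_one (by simp) k

/-- two distinct singleton classes: entropy `log 2` (the two shapes can be swapped between the two sites) -/
example : logMultinomial (univ : Finset Bool) (fun _ => 1) = Real.log 2 := by
  simp [logMultinomial]

/-- the exact split on two distinct singleton classes against a mass `Z`: `2·log Z = (2·log Z − log 2) + log 2` -/
example (Z : ℝ) :
    ∑ g ∈ (univ : Finset Bool), (((fun _ => 1 : Bool → ℕ) g : ℝ) * Real.log Z -
        Real.log (((fun _ => 1 : Bool → ℕ) g).factorial : ℝ)) =
      ((∑ g ∈ (univ : Finset Bool), (fun _ => 1 : Bool → ℕ) g : ℕ) : ℝ) * Real.log Z -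
        Real.log ((∑ g ∈ (univ : Finset Bool), (fun _ => 1 : Bool → ℕ) g).factorial : ℝ) +
        logMultinomial (univ : Finset Bool) (fun _ => 1) :=
  classes_cost_eq _ _ Z

end Sanity

/-! ## §5 (v1.1) The GIBBS form: any energies, no fibre hypothesis

The hypothesis-free parent of `logMultinomial_le_of_rank`: for ANY nonnegative «energies» `E_g` on the classes of a join,
`log(K!∕∏ k_g!) ≤ 3K + Σ_g k_g·E_g + K·log Σ_g e^{−E_g}` — Gibbs' variational inequality for the multinomial, up to the
class-linear `3K`.  The rank road is `E_g := c·r_g` with `Σ_g e^{−c r_g} ≤ 1∕(1−e^{−c})²`; the binder may equally use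
`E_g := min (c·R_g) (log G_H)` (F-leaf10-3 §3) or any other energy it can pay for. -/

/-- **THE CLASSES OF ONE JOIN WITH ENERGIES**: sizes `k g`, energies `E g ≥ 0`, one mass `Z ≥ 0`:
`Σ_g (k_g·log Z − log k_g!) ≤ 2·Σ_g k_g + Σ_g k_g·E_g + Z·Σ_g e^{−E_g}` ((d′)'s `class_cost_le` at rate `1`, classes with `k_g = 0`
contributing nothing on the left). [folklore] -/
theorem classes_cost_le_energy (Gs : Finset β) (k : β → ℕ) (E : β → ℝ) (hE : ∀ g ∈ Gs, 0 ≤ E g) {Z : ℝ} (hZ : 0 ≤ Z) :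
    ∑ g ∈ Gs, ((k g : ℝ) * Real.log Z - Real.log ((k g).factorial : ℝ)) ≤
      2 * ∑ g ∈ Gs, (k g : ℝ) + ∑ g ∈ Gs, (k g : ℝ) * E g + Z * ∑ g ∈ Gs, Real.exp (-E g) := by
  have h1 : ∀ g ∈ Gs, (k g : ℝ) * Real.log Z - Real.log ((k g).factorial : ℝ) ≤
      2 * (k g : ℝ) + (k g : ℝ) * E g + Z * Real.exp (-E g) := by
    intro g hg
    rcases Nat.eq_zero_or_pos (k g) with h0 | hpos
    · rw [h0]; simp only [Nat.cast_zero, zero_mul, Nat.factorial_zero, Nat.cast_one, Real.log_one, sub_zero,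
        mul_zero, add_zero, zero_add]
      exact mul_nonneg hZ (Real.exp_pos _).le
    · have h := class_cost_le (k := k g) hpos hZ (c := 1) (r := E g) zero_le_one (hE g hg)
      simp only [one_mul] at h
      linarith
  calc ∑ g ∈ Gs, ((k g : ℝ) * Real.log Z - Real.log ((k g).factorial : ℝ))
      ≤ ∑ g ∈ Gs, (2 * (k g : ℝ) + (k g : ℝ) * E g + Z * Real.exp (-E g)) := sum_le_sum h1
    _ = 2 * ∑ g ∈ Gs, (k g : ℝ) + ∑ g ∈ Gs, (k g : ℝ) * E g + Z * ∑ g ∈ Gs, Real.exp (-E g) := by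
        rw [mul_sum, mul_sum, ← sum_add_distrib, ← sum_add_distrib]

/-- **GIBBS' INEQUALITY FOR THE SIBLING ENTROPY** (up to `3K`): for a nonempty family of classes with sizes `k g` and ANY
energies `E g ≥ 0`, `logMultinomial ≤ 3·Σ_g k_g + Σ_g k_g·E_g + (Σ_g k_g)·log (Σ_g e^{−E_g})`.  (`classes_cost_le_energy`
at the mass `Z := K ∕ Σ_g e^{−E_g}`, the exact split `classes_cost_eq`, and `log K! ≤ K·log K`.) [folklore] -/
theorem logMultinomial_le_gibbs {Gs : Finset β} (hne : Gs.Nonempty) (k : β → ℕ) (E : β → ℝ) (hE : ∀ g ∈ Gs, 0 ≤ E g) :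
    logMultinomial Gs k ≤ 3 * ∑ g ∈ Gs, (k g : ℝ) + ∑ g ∈ Gs, (k g : ℝ) * E g +
      (∑ g ∈ Gs, (k g : ℝ)) * Real.log (∑ g ∈ Gs, Real.exp (-E g)) := by
  set K : ℕ := ∑ g ∈ Gs, k g with hK
  set W : ℝ := ∑ g ∈ Gs, Real.exp (-E g) with hW
  have hKcast : (K : ℝ) = ∑ g ∈ Gs, (k g : ℝ) := by rw [hK]; push_cast; rfl
  have hW0 : 0 < W := sum_pos (fun g _ => Real.exp_pos _) hne
  rcases Nat.eq_zero_or_pos K with hK0 | hKpos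
  · -- no parts: both sides vanish
    have hk0 : ∀ g ∈ Gs, k g = 0 := fun g hg => by
      have := single_le_sum (f := k) (fun g _ => Nat.zero_le (k g)) hg
      rw [← hK, hK0] at this
      exact Nat.le_zero.1 this
    have hL : logMultinomial Gs k = 0 := by
      unfold logMultinomial
      rw [← hK, hK0, sum_congr rfl fun g hg => by rw [hk0 g hg]]
      simp
    have hs : ∑ g ∈ Gs, (k g : ℝ) = 0 := by rw [← hKcast, hK0]; simp
    have hsE : ∑ g ∈ Gs, (k g : ℝ) * E g = 0 := sum_eq_zero fun g hg => by rw [hk0 g hg]; simp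
    rw [hL, hs, hsE]; simp
  · -- `Z := K / W`
    have hKr : (0 : ℝ) < K := by exact_mod_cast hKpos
    set Z : ℝ := (K : ℝ) / W with hZ
    have hZ0 : 0 ≤ Z := div_nonneg hKr.le hW0.le
    have hsplit := classes_cost_eq Gs k Z
    have henergy := classes_cost_le_energy Gs k E hE hZ0
    have hZW : Z * W = K := div_mul_cancel₀ (K : ℝ) hW0.ne'
    have hlogZ : Real.log Z = Real.log K - Real.log W := Real.log_div hKr.ne' hW0.ne'
    have hfact := log_factorial_le_mul_log K
    rw [← hK] at hsplit
    rw [← hW, hZW, ← hKcast] at henergy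
    rw [← hKcast]
    have hKZ : (K : ℝ) * Real.log Z = (K : ℝ) * Real.log K - (K : ℝ) * Real.log W := by rw [hlogZ]; ring
    -- logMultinomial = Σ_g(...) − (K (log K − log W) − log K!) ≤ (2K + ΣkE + K) − K log K + K log W + K log K
    linarith [hsplit, henergy, hfact, hKZ]

/-- **GIBBS WITH A PARTITION-FUNCTION BOUND**: if moreover `Σ_g e^{−E_g} ≤ W`, then
`logMultinomial ≤ 3·Σ k + Σ k·E + (Σ k)·log W` — e.g. `W = 1∕(1−e^{−c})²` on the rank road. [folklore] -/
theorem logMultinomial_le_gibbs_of_le {Gs : Finset β} (hne : Gs.Nonempty) (k : β → ℕ) (E : β → ℝ)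
    (hE : ∀ g ∈ Gs, 0 ≤ E g) {W : ℝ} (hW : ∑ g ∈ Gs, Real.exp (-E g) ≤ W) :
    logMultinomial Gs k ≤ 3 * ∑ g ∈ Gs, (k g : ℝ) + ∑ g ∈ Gs, (k g : ℝ) * E g +
      (∑ g ∈ Gs, (k g : ℝ)) * Real.log W := by
  have h := logMultinomial_le_gibbs hne k E hE
  have hpos : 0 < ∑ g ∈ Gs, Real.exp (-E g) := sum_pos (fun g _ => Real.exp_pos _) hne
  have hlog : Real.log (∑ g ∈ Gs, Real.exp (-E g)) ≤ Real.log W := Real.log_le_log hpos hW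
  have hK0 : 0 ≤ ∑ g ∈ Gs, (k g : ℝ) := sum_nonneg fun g _ => Nat.cast_nonneg _
  nlinarith [mul_le_mul_of_nonneg_left hlog hK0]

namespace Sanity

/-- Gibbs on two distinct singleton classes with zero energies: `log 2 ≤ 3·2 + 0 + 2·log 2` -/
example : logMultinomial (univ : Finset Bool) (fun _ => 1) ≤
    3 * ∑ g ∈ (univ : Finset Bool), (((fun _ => 1 : Bool → ℕ) g : ℕ) : ℝ) +
      ∑ g ∈ (univ : Finset Bool), (((fun _ => 1 : Bool → ℕ) g : ℕ) : ℝ) * (fun _ => (0 : ℝ)) g +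
      (∑ g ∈ (univ : Finset Bool), (((fun _ => 1 : Bool → ℕ) g : ℕ) : ℝ)) *
        Real.log (∑ g ∈ (univ : Finset Bool), Real.exp (-(fun _ => (0 : ℝ)) g)) :=
  logMultinomial_le_gibbs univ_nonempty _ _ fun _ _ => le_rfl

end Sanity

end

end Summit.QuantumFields.BalabanUV.T4Continuum.HistorySiblingEntropy
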